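import Literature.NumberTheory.LFunctions.ZetaZeroSumsLehmanExplicit
import Literature.NumberTheory.LFunctions.LindelofBacklundNecessity
import Literature.NumberTheory.LFunctions.SoundZeroWindowSums
import Mathlib.Analysis.SpecialFunctions.Gamma.Basic
import HarnessLib

/-!
# RH-FREE — Explicit partial sums `Σ 1/γ` over the zeros of `ζ` from counts: Fiori–Kadiri–Swidinsky 2023, §2 (Lemma 2.1, Table 1, Corollary 2.3, Lemma 2.5, Remark 2.6) («nothing here bears on the truth of RH»)

Topic `Literature/NumberTheory/LFunctions` (RH literature-typing tranche 1, L4 "explicit zero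
statistics", gen 5). Label: **RH-FREE** — unconditional statements about the ordinates `γ` (and,
for Lemma 2.5, the real parts `β`) of the non-trivial zeros; refereed source (J. Math. Anal. Appl.
527 (2023) 127426 = arXiv:2204.02588v3). Nothing here bears on the truth of RH.

NUMBERING (audited 2026-08-27 against the compiled arXiv v3 PDF, whose theorem-like environments —
lemmas, corollaries, theorems, propositions AND remarks — share one counter per section): the `B₀`
lemma is **Lemma 2.5**, the `Γ(3,x)` remark is **Remark 2.6**, the table of values `S₀` is
**Table 1**, and `B₁`, `S₀`, `s₀`, `Γ(s,x)`, `B₀`, `J_{a,b}`, `Γ(3,x)` are eqs. (2.1), (2.4), (2.7),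
(2.8), (2.10), (2.11), (2.12). The declaration names `FioriKadiriSwidinsky2023_lemma24`,
`FioriKadiriSwidinsky2023_table2`, `FKS2023.recipZeroTable2` (and the importers'
`ZetaZeroReciprocalSumsTable2Low`) keep the labels of an earlier miscount (`lemma24` = Lemma 2.5,
`table2` = Table 1); only the names, not the statements or the cites, carry the old labels.

The two "preliminary lemmas" by which Fiori–Kadiri–Swidinsky (and, in the same shape,
Faber–Kadiri 2015, Broadbent et al. 2021, Johnston–Yang 2023, Platt–Trudgian 2021) convert an
explicit zero-counting bound into explicit bounds for the partial sums over zeros that drive every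
explicit `|ψ(x) − x|` estimate:

* **Lemma 2.1** (PROVED, `sum_inv_le_B₁_of_count`, `FioriKadiriSwidinsky2023_lemma21`): if
  `|N(T) − ((T/2π) log(T/2πe) + 7/8)| ≤ R(T) = b₁ log T + b₂ log log T + b₃`, then
  `Σ_{U ≤ γ < V} 1/γ ≤ B₁(U,V) = (1/2π + (b₁ log U + b₂)/(U log U log(U/2π))) log(V/U) log(√(VU)/2π) + 2R(U)/U`
  (`FKS2023.B₁`, eq. (2.1)). Proof as indicated in print ("the calculations following
  [Faber–Kadiri 2015, Cor. 2.6], based on [Rosser–Schoenfeld 1975, Lemma 7]"): the tree's exact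
  Lehman/Rosser–Schoenfeld partial summation `lehman_identity` with `φ(t) = 1/t`, then
  `∫_U^V R(t) dt/t² ≤ R(U)/U − R(V)/V + (b₁ + b₂/log U)(1/U − 1/V)` and `1 − U/V ≤ log(V/U)`.
* **Table 1** (NAMED FACT `FioriKadiriSwidinsky2023_table2`, the only fact of this file): the ten
  printed values `S₀` with `S₀ − 10⁻¹⁰ < Σ_{0<γ<T₀} 1/γ < S₀`, `T₀ = 10², …, 10¹⁰, 30 610 046 000`,
  computed from Platt's rigorous zeros (LMFDB). The rows `T₀ = 100, 1000` are moreover THEOREMS of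
  the tree (`ZetaZeroReciprocalSumsTable2Low.lean`, from the certified first `2000` zeros).
* **Corollary 2.3** (PROVED from the fact and Lemma 2.1, `FioriKadiriSwidinsky2023_cor23`): for
  `V > T₀`, `Σ_{0<γ<V} 1/γ < S₀ + B₁(T₀, V)`.
* **Lemma 2.5** (PROVED, `FioriKadiriSwidinsky2023_lemma24`): if `N(σ,T) ≤ Ñ(σ,T) =
  c₁ T^p (log T)^q + c₂ (log T)²` for `T ≥ T₀` (a "(ZDB)" majorant, `FKS2023.zdbMajorant`,
  `0 < p < 1`, `q > 0`), then for `T₀ ≤ U < V`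
  `s₀(σ,U,V) = Σ_{U≤γ<V, β≥σ} 1/γ ≤ B₀(σ,U,V)` with `B₀` the printed expression (2.10) in the upper
  incomplete Gamma function `Γ(s,x) = ∫_x^∞ t^{s−1}e^{−t} dt` (`upperIncGamma`, `FKS2023.B₀`).
  Proof as printed: Stieltjes integration by parts against `N(σ,·)` (here
  `sum_zerosBetweenRe_eq`, the `σ`-restricted twin of the tree's `SchoenfeldBound.sum_zerosBetween_eq`),
  `N ≤ Ñ`, and `J_{a,b}(T) = ∫_T^∞ (log y)^a y^{−b} dy = Γ(a+1,(b−1) log T)/(b−1)^{a+1}`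
  (`integral_log_rpow_div_rpow`, by the substitution `y = e^{t/(b−1)}`).
* **Remark 2.6** (PROVED, `upperIncGamma_three`): `Γ(3,x) = (x² + 2(x+1)) e^{−x}`.

## Conventions (equivalence with print)

FKS count `N(T)`, `N(σ,T)` with `0 < γ < T` and sum over `U ≤ γ < V`; the tree counts `0 < γ ≤ T`
(`zetaZeroCount`, `zetaZeroCountRe`, both right-continuous) and its windows are `U < γ ≤ V`
(`SchoenfeldBound.zerosBetween`, and `zerosBetweenRe σ U V` below for `β ≥ σ`). The core bounds
are proved for the tree's windows (`sum_inv_le_B₁_of_count`, `sum_inv_le_B₀_of_countRe`) and then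
for the CLOSED windows `U ≤ γ ≤ V` (`FioriKadiriSwidinsky2023_lemma21`, `…_lemma24`, stated with a
`Finset.filter (U ≤ Im ·)` over a larger tree window), which contain the printed half-open ones —
all terms are positive, so the closed-window bound implies every endpoint convention. The passage
from `(U',V]`, `U' ↑ U`, to `[U,V]` uses that the zeros are finite in number below `V`
(`exists_noOrdinate_Ioo`) and that `B₁(·,V)`, `B₀(·,V)` are continuous. The counting hypotheses
are continuous in `T`, so assuming them for the right-continuous `N` is equivalent to assuming them
for FKS's left-continuous count. Table 1's `Σ_{0<γ<T₀}` is rendered exactly: "`< S₀` for every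
truncation `0 < γ ≤ T` with `T < T₀`, and `> S₀ − 10⁻¹⁰` for some such truncation". Lemma 2.5 is
printed with the extra hypotheses `σ ≥ 5/8`, `c₁, c₂ > 0`, which its proof does not use; they are
omitted (the Lean statement is the printed one for every `σ`). Sums are weighted by the
multiplicity `m(ρ) = riemannZetaZeroOrder ρ` ("zeros counted with multiplicity").

## References

* A. Fiori, H. Kadiri, J. Swidinsky, *Sharper bounds for the Chebyshev function ψ(x)* (v1 title:
  *Density results for the zeros of zeta applied to the error term in the prime number theorem*),
  J. Math. Anal. Appl. 527 (2023) 127426 (arXiv:2204.02588v3), §2.1 Lemma 2.1 (eq. (2.1)), Remark 2.2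
  (eq. (2.2)), Corollary 2.3 (eqs. (2.3)–(2.4)), Table 1; §2.2 Definition (ZDB) (eqs. (2.5)–(2.6)),
  eq. (2.7) (`s₀`), eq. (2.8) (`Γ(s,x)`), Lemma 2.5 (eqs. (2.9)–(2.11)), Remark 2.6 (eq. (2.12)).
  [FioriKadiriSwidinsky2023]
* L. Faber, H. Kadiri, *New bounds for ψ(x)*, Math. Comp. 84 (2015) 1339–1357, Cor. 2.6 (the
  calculation behind Lemma 2.1). [FaberKadiri2014]
* J. B. Rosser, L. Schoenfeld, Math. Comp. 29 (1975) 243–269, Lemma 7 (partial summation against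
  `N`, the tree's `SchoenfeldBound.sum_zerosBetween_eq`). [RosserSchoenfeld1975]
* D. J. Platt, *Isolating some non-trivial zeros of zeta*, Math. Comp. 86 (2017) 2449–2467 (the
  zeros behind Table 1). [Platt2017]
* NIST Digital Library of Mathematical Functions, §8.2 eq. 8.2.2 (`Γ(a,z)`), §8.8 eq. 8.8.13
  (`dΓ(a,z)/dz = −z^{a−1}e^{−z}`), §8.4 eq. 8.4.8 (`Γ(n+1,z) = n! e^{−z} e_n(z)`). [DLMF]
* E. C. Titchmarsh, *The Theory of the Riemann Zeta-Function*, 2nd ed., §9.1–9.2 (the counting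
  functions; finitely many zeros below any height). [Titchmarsh1986]
-/

noncomputable section

open Complex Filter Set MeasureTheory intervalIntegral Topology
open scoped Real

namespace Literature.NumberTheory.LFunctions

open SchoenfeldBound

/-! ## The printed quantities -/

namespace FKS2023

/-- The error majorant of Lemma 2.1: `R(T) = b₁ log T + b₂ log log T + b₃` (Rosser:
`0.137, 0.443, 1.588`; Hasanalizade–Shen–Wong: `0.1038, 0.2573, 9.3675`, Remark 2.2).
[cite: FioriKadiriSwidinsky2023, Lemma 2.1] -/
def countErr (b₁ b₂ b₃ T : ℝ) : ℝ := b₁ * Real.log T + b₂ * Real.log (Real.log T) + b₃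

/-- **`B₁(U,V)`** of eq. (2.1):
`(1/(2π) + (b₁ log U + b₂)/(U log U log(U/2π))) · (log(V/U) log(√(VU)/(2π))) + 2R(U)/U`.
[cite: FioriKadiriSwidinsky2023, Lemma 2.1 eq. (2.1)] -/
def B₁ (b₁ b₂ b₃ U V : ℝ) : ℝ :=
  (1 / (2 * π) + (b₁ * Real.log U + b₂) / (U * Real.log U * Real.log (U / (2 * π))))
      * (Real.log (V / U) * Real.log (Real.sqrt (V * U) / (2 * π)))
    + 2 * countErr b₁ b₂ b₃ U / U

/-- **Table 1** ("Tight upper bounds for values of reciprocal sums of zeros up to height `T₀` using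
Platt's tabulations, see (2.4)"): the ten printed rows `(T₀, S₀)`.
[cite: FioriKadiriSwidinsky2023, Table 1] -/
def recipZeroTable2 : List (ℝ × ℝ) :=
  [(100, 0.5922435112), (1000, 2.0286569752), (10000, 4.3080354951), (100000, 7.4318184970),
   (1000000, 11.3993199147), (10000000, 16.2106480369), (100000000, 21.8657999924),
   (1000000000, 28.3647752011), (10000000000, 35.7075737123), (30610046000, 39.5797647802)]

/-- The (ZDB) majorant of §2.2, eq. (2.6): `Ñ(σ,T) = c₁ T^p (log T)^q + c₂ (log T)²` (the values
`c₁(σ), c₂(σ), p(σ), q(σ)` at a fixed `σ` are the real parameters). Real powers are `Real.rpow`.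
[cite: FioriKadiriSwidinsky2023, §2.2 Definition (ZDB) eq. (2.6)] -/
def zdbMajorant (c₁ c₂ p q T : ℝ) : ℝ := c₁ * T ^ p * Real.log T ^ q + c₂ * Real.log T ^ 2

end FKS2023

/-- The upper incomplete Gamma function `Γ(s, x) = ∫_x^∞ t^{s−1} e^{−t} dt` (used for `x > 0`,
`s > 0`). [cite: DLMF, §8.2 eq. 8.2.2] [cite: FioriKadiriSwidinsky2023, §2.2 eq. (2.8)] -/
def upperIncGamma (s x : ℝ) : ℝ := ∫ t in Ioi x, t ^ (s - 1) * Real.exp (-t)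

namespace FKS2023

/-- **`B₀(σ,U,V)`** of eq. (2.10):
`c₁ (log V)^q/V^{1−p} + c₂ (log V)²/V + c₁/(1−p)^{q+1} (Γ(q+1,(1−p)log U) − Γ(q+1,(1−p)log V))
 + c₂ (Γ(3,log U) − Γ(3,log V))`. [cite: FioriKadiriSwidinsky2023, Lemma 2.5 eq. (2.10)] -/
def B₀ (c₁ c₂ p q U V : ℝ) : ℝ :=
  c₁ * Real.log V ^ q / V ^ (1 - p) + c₂ * Real.log V ^ 2 / V
    + c₁ / (1 - p) ^ (q + 1) *
        (upperIncGamma (q + 1) ((1 - p) * Real.log U) - upperIncGamma (q + 1) ((1 - p) * Real.log V))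
    + c₂ * (upperIncGamma 3 (Real.log U) - upperIncGamma 3 (Real.log V))

end FKS2023

/-! ## Lemma 2.1: `Σ_{U<γ≤V} 1/γ ≤ B₁(U,V)` from `|N − L| ≤ R` -/

/-- `∫_U^V R(t)/t² dt ≤ R(U)/U − R(V)/V + (b₁ + b₂/log U)(1/U − 1/V)` for `1 < U ≤ V`, `b₂ ≥ 0`
(`G(t) = −R(t)/t − (b₁ + b₂/log U)/t` has `G' = R/t² + b₂(1/log U − 1/log t)/t² ≥ R/t²`).
[cite: FioriKadiriSwidinsky2023, Lemma 2.1 (proof, "the calculations following [FabKad15, Cor. 2.6]")] -/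
theorem FKS2023.integral_countErr_div_sq_le {b₁ b₂ b₃ U V : ℝ} (hb₂ : 0 ≤ b₂) (hU : 1 < U)
    (hUV : U ≤ V) :
    ∫ t in U..V, FKS2023.countErr b₁ b₂ b₃ t / t ^ 2 ≤
      FKS2023.countErr b₁ b₂ b₃ U / U - FKS2023.countErr b₁ b₂ b₃ V / V
        + (b₁ + b₂ / Real.log U) * (1 / U - 1 / V) := by
  have hIcc : uIcc U V = Icc U V := uIcc_of_le hUV
  set R : ℝ → ℝ := FKS2023.countErr b₁ b₂ b₃ with hRdef
  have hLU : 0 < Real.log U := Real.log_pos hU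
  have hRat : ∀ t, R t = b₁ * Real.log t + b₂ * Real.log (Real.log t) + b₃ := fun t ↦ rfl
  -- the comparison function `G(t) = -R(t)/t - κ/t`, `κ = b₁ + b₂/log U`, and its derivative
  have hderiv : ∀ t ∈ Icc U V, HasDerivAt (fun s ↦ -(R s) * s⁻¹ - (b₁ + b₂ / Real.log U) * s⁻¹)
      (R t / t ^ 2 + b₂ * (1 / Real.log U - 1 / Real.log t) / t ^ 2) t := by
    intro t ht
    have ht1 : 1 < t := hU.trans_le ht.1
    have ht0 : 0 < t := by linarith
    have hlt : 0 < Real.log t := Real.log_pos ht1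
    have h1 : HasDerivAt (fun s : ℝ ↦ Real.log s) t⁻¹ t := Real.hasDerivAt_log ht0.ne'
    have h2 : HasDerivAt (fun s : ℝ ↦ Real.log (Real.log s)) ((Real.log t)⁻¹ * t⁻¹) t :=
      (Real.hasDerivAt_log hlt.ne').comp t h1
    have hR : HasDerivAt R (b₁ * t⁻¹ + b₂ * ((Real.log t)⁻¹ * t⁻¹)) t := by
      have h : HasDerivAt (fun s ↦ b₁ * Real.log s + b₂ * Real.log (Real.log s) + b₃)
          (b₁ * t⁻¹ + b₂ * ((Real.log t)⁻¹ * t⁻¹)) t :=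
        ((h1.const_mul b₁).add (h2.const_mul b₂)).add_const b₃
      have e : (fun s ↦ b₁ * Real.log s + b₂ * Real.log (Real.log s) + b₃) = R := by
        funext s; rw [hRat]
      rwa [e] at h
    have hinv : HasDerivAt (fun s : ℝ ↦ s⁻¹) (-(t ^ 2)⁻¹) t := hasDerivAt_inv ht0.ne'
    have hG1 : HasDerivAt (fun s ↦ -(R s) * s⁻¹)
        (-(b₁ * t⁻¹ + b₂ * ((Real.log t)⁻¹ * t⁻¹)) * t⁻¹ + -(R t) * (-(t ^ 2)⁻¹)) t :=
      hR.neg.mul hinv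
    have hG2 : HasDerivAt (fun s : ℝ ↦ (b₁ + b₂ / Real.log U) * s⁻¹)
        ((b₁ + b₂ / Real.log U) * (-(t ^ 2)⁻¹)) t := hinv.const_mul _
    have h : HasDerivAt (fun s ↦ -(R s) * s⁻¹ - (b₁ + b₂ / Real.log U) * s⁻¹)
        (-(b₁ * t⁻¹ + b₂ * ((Real.log t)⁻¹ * t⁻¹)) * t⁻¹ + -(R t) * (-(t ^ 2)⁻¹)
          - (b₁ + b₂ / Real.log U) * (-(t ^ 2)⁻¹)) t := hG1.sub hG2
    refine h.congr_deriv ?_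
    field_simp
    ring
  have hRc : ∀ t ∈ Icc U V, ContinuousAt R t := by
    intro t ht
    have ht1 : 1 < t := hU.trans_le ht.1
    have ht0 : 0 < t := by linarith
    have hlt : 0 < Real.log t := Real.log_pos ht1
    have hlogc : ContinuousAt (fun s : ℝ ↦ Real.log s) t := Real.continuousAt_log ht0.ne'
    have hllc : ContinuousAt (fun s : ℝ ↦ Real.log (Real.log s)) t :=
      (Real.continuousAt_log hlt.ne').comp hlogc
    have e : (fun s ↦ b₁ * Real.log s + b₂ * Real.log (Real.log s) + b₃) = R := by
      funext s; rw [hRat]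
    rw [← e]
    exact ((continuousAt_const.mul hlogc).add (continuousAt_const.mul hllc)).add continuousAt_const
  have hG'c : ContinuousOn (fun t ↦ R t / t ^ 2 + b₂ * (1 / Real.log U - 1 / Real.log t) / t ^ 2)
      (Icc U V) := by
    intro t ht
    have ht1 : 1 < t := hU.trans_le ht.1
    have ht0 : 0 < t := by linarith
    have hlt : 0 < Real.log t := Real.log_pos ht1
    have hlogc : ContinuousAt (fun s : ℝ ↦ Real.log s) t := Real.continuousAt_log ht0.ne'
    have ht2 : ContinuousAt (fun s : ℝ ↦ s ^ 2) t := continuousAt_id.pow 2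
    have hne : (fun s : ℝ ↦ s ^ 2) t ≠ 0 := by simp only [ne_eq]; positivity
    have hA : ContinuousAt (fun s ↦ R s / s ^ 2) t := (hRc t ht).div ht2 hne
    have hB : ContinuousAt (fun s : ℝ ↦ b₂ * (1 / Real.log U - 1 / Real.log s) / s ^ 2) t := by
      refine (continuousAt_const.mul (continuousAt_const.sub ?_)).div ht2 hne
      exact continuousAt_const.div hlogc hlt.ne'
    exact (hA.add hB).continuousWithinAt
  have hRi : IntervalIntegrable (fun t ↦ R t / t ^ 2) volume U V := by
    refine ContinuousOn.intervalIntegrable_of_Icc hUV fun t ht ↦ ?_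
    have ht0 : 0 < t := by linarith [hU.trans_le ht.1]
    have hne : (fun s : ℝ ↦ s ^ 2) t ≠ 0 := by simp only [ne_eq]; positivity
    exact ((hRc t ht).div (continuousAt_id.pow 2) hne).continuousWithinAt
  have hmono : ∫ t in U..V, R t / t ^ 2 ≤
      ∫ t in U..V, (R t / t ^ 2 + b₂ * (1 / Real.log U - 1 / Real.log t) / t ^ 2) := by
    refine intervalIntegral.integral_mono_on hUV hRi (hG'c.intervalIntegrable_of_Icc hUV) ?_
    intro t ht
    have ht1 : 1 < t := hU.trans_le ht.1
    have ht0 : 0 < t := by linarith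
    have hlog_le : Real.log U ≤ Real.log t := Real.log_le_log (by linarith) ht.1
    have hextra : 0 ≤ b₂ * (1 / Real.log U - 1 / Real.log t) / t ^ 2 := by
      apply div_nonneg _ (by positivity)
      apply mul_nonneg hb₂
      rw [sub_nonneg]
      exact one_div_le_one_div_of_le hLU hlog_le
    linarith
  have hFTC : ∫ t in U..V, (R t / t ^ 2 + b₂ * (1 / Real.log U - 1 / Real.log t) / t ^ 2) =
      (-(R V) * V⁻¹ - (b₁ + b₂ / Real.log U) * V⁻¹)
        - (-(R U) * U⁻¹ - (b₁ + b₂ / Real.log U) * U⁻¹) := by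
    refine integral_eq_sub_of_hasDerivAt (fun t ht ↦ hderiv t (by rwa [hIcc] at ht)) ?_
    exact hG'c.intervalIntegrable_of_Icc hUV
  rw [hFTC] at hmono
  have e : (-(R V) * V⁻¹ - (b₁ + b₂ / Real.log U) * V⁻¹)
        - (-(R U) * U⁻¹ - (b₁ + b₂ / Real.log U) * U⁻¹) =
      R U / U - R V / V + (b₁ + b₂ / Real.log U) * (1 / U - 1 / V) := by ring
  rw [e] at hmono
  exact hmono

/-- **FKS Lemma 2.1 in the tree's window convention.** If `|N(t) − L(t)| ≤ R(t) = b₁ log t +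
b₂ log log t + b₃` on `[U, V]` (`L(t) = (t/2π) log(t/2πe) + 7/8 = countMain t`), with `b₁, b₂ ≥ 0`
and `2π < U ≤ V`, then `Σ_{U<γ≤V} m(ρ)/γ ≤ B₁(U,V)`.
[cite: FioriKadiriSwidinsky2023, Lemma 2.1] -/
theorem sum_inv_le_B₁_of_count {b₁ b₂ b₃ U V : ℝ} (hb₁ : 0 ≤ b₁) (hb₂ : 0 ≤ b₂)
    (hU : 2 * π < U) (hUV : U ≤ V)
    (hR : ∀ t ∈ Icc U V, |(zetaZeroCount t : ℝ) - countMain t| ≤ FKS2023.countErr b₁ b₂ b₃ t) :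
    ∑ ρ ∈ zerosBetween U V, (riemannZetaZeroOrder ρ : ℝ) * (1 / ρ.im) ≤ FKS2023.B₁ b₁ b₂ b₃ U V := by
  have hπ : 3 < π := Real.pi_gt_three
  have h2π : (0 : ℝ) < 2 * π := by positivity
  have hU1 : 1 < U := by linarith
  have hU0 : 0 < U := by linarith
  have hV0 : 0 < V := by linarith
  have hIcc : uIcc U V = Icc U V := uIcc_of_le hUV
  have hLU : 0 < Real.log U := Real.log_pos hU1
  have hLU2π : 0 < Real.log (U / (2 * π)) := Real.log_pos (by rwa [lt_div_iff₀ h2π, one_mul])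
  -- φ = 1/s
  have hφ : ∀ t ∈ Icc U V, HasDerivAt (fun s : ℝ ↦ 1 / s) (-1 / t ^ 2) t := by
    intro t ht
    have ht0 : 0 < t := hU0.trans_le ht.1
    have h := hasDerivAt_inv ht0.ne'
    have h' := h.congr_of_eventuallyEq (f₁ := fun s : ℝ ↦ 1 / s)
      (Filter.Eventually.of_forall fun s ↦ by simp only [one_div])
    refine h'.congr_deriv ?_
    field_simp
  have hφ' : ContinuousOn (fun t : ℝ ↦ -1 / t ^ 2) (Icc U V) := fun t ht ↦ by
    have ht0 : 0 < t := hU0.trans_le ht.1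
    have hne : (fun x : ℝ ↦ x ^ 2) t ≠ 0 := by simp only [ne_eq]; positivity
    exact (continuousAt_const.div (continuousAt_id.pow 2) hne).continuousWithinAt
  have hI := FKS2023.integral_countErr_div_sq_le (b₁ := b₁) (b₃ := b₃) hb₂ hU1 hUV
  rw [lehman_identity hU0 hUV hφ hφ', integral_inv_mul_log hU0 hUV]
  unfold FKS2023.B₁
  set R : ℝ → ℝ := FKS2023.countErr b₁ b₂ b₃ with hRdef
  have hRat : ∀ t, R t = b₁ * Real.log t + b₂ * Real.log (Real.log t) + b₃ := fun t ↦ rfl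
  -- boundary terms
  have hbV : ((zetaZeroCount V : ℝ) - countMain V) * (1 / V) ≤ R V / V := by
    have := (le_abs_self _).trans (hR V ⟨hUV, le_rfl⟩)
    rw [mul_one_div]
    exact div_le_div_of_nonneg_right this hV0.le
  have hbU : -(((zetaZeroCount U : ℝ) - countMain U) * (1 / U)) ≤ R U / U := by
    have := (neg_le_abs _).trans (hR U ⟨le_rfl, hUV⟩)
    rw [mul_one_div, ← neg_div]
    exact div_le_div_of_nonneg_right this hU0.le
  -- the integral term: -∫ Q (-1/t²) = ∫ Q/t² ≤ ∫ R/t²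
  have hcont : ∀ t ∈ Icc U V, ContinuousAt R t := by
    intro t ht
    have ht1 : 1 < t := hU1.trans_le ht.1
    have ht0 : 0 < t := by linarith
    have hlt : 0 < Real.log t := Real.log_pos ht1
    have hlogc : ContinuousAt (fun s : ℝ ↦ Real.log s) t := Real.continuousAt_log ht0.ne'
    have hllc : ContinuousAt (fun s : ℝ ↦ Real.log (Real.log s)) t :=
      (Real.continuousAt_log hlt.ne').comp hlogc
    have e : (fun s ↦ b₁ * Real.log s + b₂ * Real.log (Real.log s) + b₃) = R := by
      funext s; rw [hRat]
    rw [← e]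
    exact ((continuousAt_const.mul hlogc).add (continuousAt_const.mul hllc)).add continuousAt_const
  have hQi : IntervalIntegrable (fun t ↦ ((zetaZeroCount t : ℝ) - countMain t) * (-1 / t ^ 2))
      volume U V := by
    have hNi : IntervalIntegrable (fun t ↦ ((zetaZeroCount t : ℝ) - zetaZeroCount U) * (-1 / t ^ 2))
        volume U V := intervalIntegrable_count_sub_mul (by rw [hIcc]; exact hφ')
    have hcMi : IntervalIntegrable (fun t ↦ countMain t * (-1 / t ^ 2)) volume U V :=
      ((continuousOn_countMain hU0).mul hφ').intervalIntegrable_of_Icc hUV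
    have hKi : IntervalIntegrable (fun t ↦ (zetaZeroCount U : ℝ) * (-1 / t ^ 2)) volume U V :=
      (hφ'.intervalIntegrable_of_Icc hUV).const_mul _
    have : (fun t ↦ ((zetaZeroCount t : ℝ) - countMain t) * (-1 / t ^ 2)) =
        fun t ↦ ((zetaZeroCount t : ℝ) - zetaZeroCount U) * (-1 / t ^ 2)
          + ((zetaZeroCount U : ℝ) * (-1 / t ^ 2) - countMain t * (-1 / t ^ 2)) := by
      funext t; ring
    rw [this]
    exact hNi.add (hKi.sub hcMi)
  have hR2i : IntervalIntegrable (fun t ↦ R t / t ^ 2) volume U V := by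
    refine ContinuousOn.intervalIntegrable_of_Icc hUV fun t ht ↦ ?_
    have ht0 : 0 < t := hU0.trans_le ht.1
    have hne : (fun x : ℝ ↦ x ^ 2) t ≠ 0 := by simp only [ne_eq]; positivity
    exact ((hcont t ht).div (continuousAt_id.pow 2) hne).continuousWithinAt
  have hint : -(∫ t in U..V, ((zetaZeroCount t : ℝ) - countMain t) * (-1 / t ^ 2)) ≤
      ∫ t in U..V, R t / t ^ 2 := by
    rw [← intervalIntegral.integral_neg]
    refine intervalIntegral.integral_mono_on hUV hQi.neg hR2i fun t ht ↦ ?_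
    have ht0 : 0 < t := hU0.trans_le ht.1
    have h1 := hR t ht
    have ht2 : 0 < t ^ 2 := by positivity
    have : -(((zetaZeroCount t : ℝ) - countMain t) * (-1 / t ^ 2)) =
        ((zetaZeroCount t : ℝ) - countMain t) / t ^ 2 := by ring
    rw [this]
    exact div_le_div_of_nonneg_right ((le_abs_self _).trans h1) ht2.le
  -- 1/U - 1/V ≤ log(V/U)/U ≤ log(V/U) log(√(VU)/2π) / (U log(U/2π))
  have hlogVU : 0 ≤ Real.log (V / U) := Real.log_nonneg (by rwa [le_div_iff₀ hU0, one_mul])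
  have h1 : 1 / U - 1 / V ≤ Real.log (V / U) / U := by
    have h := Real.one_sub_inv_le_log_of_pos (show 0 < V / U by positivity)
    rw [inv_div] at h
    have : 1 / U - 1 / V = (1 - U / V) / U := by field_simp
    rw [this]
    exact div_le_div_of_nonneg_right h hU0.le
  have hsqrt : Real.log (U / (2 * π)) ≤ Real.log (Real.sqrt (V * U) / (2 * π)) := by
    apply Real.log_le_log (by positivity)
    apply div_le_div_of_nonneg_right _ h2π.le
    rw [Real.le_sqrt hU0.le (by positivity)]
    nlinarith
  have hL2 : 0 < Real.log (Real.sqrt (V * U) / (2 * π)) := hLU2π.trans_le hsqrt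
  -- the main term identity: (log²(V/2π) − log²(U/2π))/2 = log(V/U) log(√(VU)/2π)
  have hmain : (Real.log (V / (2 * π)) ^ 2 - Real.log (U / (2 * π)) ^ 2) / 2 =
      Real.log (V / U) * Real.log (Real.sqrt (V * U) / (2 * π)) := by
    have eVU : Real.log (V / U) = Real.log (V / (2 * π)) - Real.log (U / (2 * π)) := by
      rw [Real.log_div hV0.ne' hU0.ne', Real.log_div hV0.ne' h2π.ne', Real.log_div hU0.ne' h2π.ne']
      ring
    have eS : Real.log (Real.sqrt (V * U) / (2 * π)) =
        (Real.log (V / (2 * π)) + Real.log (U / (2 * π))) / 2 := by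
      rw [Real.log_div (Real.sqrt_pos.2 (by positivity)).ne' h2π.ne', Real.log_sqrt (by positivity),
        Real.log_mul hV0.ne' hU0.ne', Real.log_div hV0.ne' h2π.ne', Real.log_div hU0.ne' h2π.ne']
      ring
    rw [eVU, eS]; ring
  -- assemble
  have hκ0 : 0 ≤ b₁ + b₂ / Real.log U := by positivity
  have h2 : (b₁ + b₂ / Real.log U) * (1 / U - 1 / V) ≤
      (b₁ * Real.log U + b₂) / (U * Real.log U * Real.log (U / (2 * π)))
        * (Real.log (V / U) * Real.log (Real.sqrt (V * U) / (2 * π))) := by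
    calc (b₁ + b₂ / Real.log U) * (1 / U - 1 / V)
        ≤ (b₁ + b₂ / Real.log U) * (Real.log (V / U) / U) := mul_le_mul_of_nonneg_left h1 hκ0
      _ = (b₁ * Real.log U + b₂) / (U * Real.log U * Real.log (U / (2 * π)))
            * (Real.log (V / U) * Real.log (U / (2 * π))) := by
          field_simp
      _ ≤ (b₁ * Real.log U + b₂) / (U * Real.log U * Real.log (U / (2 * π)))
            * (Real.log (V / U) * Real.log (Real.sqrt (V * U) / (2 * π))) := by
          apply mul_le_mul_of_nonneg_left _ (by positivity)
          exact mul_le_mul_of_nonneg_left hsqrt hlogVU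
  rw [hmain]
  have hstep : ((zetaZeroCount V : ℝ) - countMain V) * (1 / V)
      - ((zetaZeroCount U : ℝ) - countMain U) * (1 / U)
      - (∫ t in U..V, ((zetaZeroCount t : ℝ) - countMain t) * (-1 / t ^ 2)) ≤
      2 * R U / U + (b₁ * Real.log U + b₂) / (U * Real.log U * Real.log (U / (2 * π)))
        * (Real.log (V / U) * Real.log (Real.sqrt (V * U) / (2 * π))) := by
    have hRU2 : R U / U + R U / U = 2 * R U / U := by ring
    linarith [hbV, hbU, hint, hI, h2]
  have e : (1 / (2 * π) + (b₁ * Real.log U + b₂) / (U * Real.log U * Real.log (U / (2 * π))))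
        * (Real.log (V / U) * Real.log (Real.sqrt (V * U) / (2 * π))) + 2 * R U / U =
      Real.log (V / U) * Real.log (Real.sqrt (V * U) / (2 * π)) / (2 * π)
        + (2 * R U / U + (b₁ * Real.log U + b₂) / (U * Real.log U * Real.log (U / (2 * π)))
          * (Real.log (V / U) * Real.log (Real.sqrt (V * U) / (2 * π)))) := by ring
  rw [e]
  linarith [hstep]

/-! ## From the tree's windows `(U',V]` to the closed windows `[U,V]` -/

/-- **`B₁(·, V)` is continuous at every `U > 2π`** (`V > 0`). [cite: FioriKadiriSwidinsky2023, Lemma 2.1 eq. (2.1)] -/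
theorem FKS2023.continuousAt_B₁ {b₁ b₂ b₃ U V : ℝ} (hU : 2 * π < U) (hV : 0 < V) :
    ContinuousAt (fun u ↦ FKS2023.B₁ b₁ b₂ b₃ u V) U := by
  have hπ : 3 < π := Real.pi_gt_three
  have h2π : (0 : ℝ) < 2 * π := by positivity
  have hU0 : 0 < U := by linarith
  have hlogU : 0 < Real.log U := Real.log_pos (by linarith)
  have hlogU2π : 0 < Real.log (U / (2 * π)) := Real.log_pos (by rwa [lt_div_iff₀ h2π, one_mul])
  have hlog : ContinuousAt (fun u : ℝ ↦ Real.log u) U := Real.continuousAt_log hU0.ne'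
  have hll : ContinuousAt (fun u : ℝ ↦ Real.log (Real.log u)) U := hlog.log hlogU.ne'
  have hl2π : ContinuousAt (fun u : ℝ ↦ Real.log (u / (2 * π))) U :=
    (continuousAt_id.div_const (2 * π)).log (div_pos hU0 h2π).ne'
  have hlVu : ContinuousAt (fun u : ℝ ↦ Real.log (V / u)) U :=
    (continuousAt_const.div continuousAt_id hU0.ne').log (div_pos hV hU0).ne'
  have hsq : ContinuousAt (fun u : ℝ ↦ Real.log (Real.sqrt (V * u) / (2 * π))) U :=
    ((Real.continuous_sqrt.continuousAt.comp (continuousAt_const.mul continuousAt_id)).div_const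
      (2 * π)).log (div_pos (Real.sqrt_pos.2 (mul_pos hV hU0)) h2π).ne'
  have hR : ContinuousAt (fun u : ℝ ↦ FKS2023.countErr b₁ b₂ b₃ u) U := by
    unfold FKS2023.countErr
    exact ((continuousAt_const.mul hlog).add (continuousAt_const.mul hll)).add continuousAt_const
  have hden : ContinuousAt (fun u : ℝ ↦ u * Real.log u * Real.log (u / (2 * π))) U :=
    (continuousAt_id.mul hlog).mul hl2π
  have hden0 : (fun u : ℝ ↦ u * Real.log u * Real.log (u / (2 * π))) U ≠ 0 := by
    simp only [ne_eq]; positivity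
  unfold FKS2023.B₁
  refine ((continuousAt_const.add (((continuousAt_const.mul hlog).add continuousAt_const).div hden
    hden0)).mul (hlVu.mul hsq)).add ((continuousAt_const.mul hR).div continuousAt_id hU0.ne')

/-- Sums of `m(ρ)/γ` over sub-windows are monotone: for a finite set of zeros `S ⊆ zerosBetween U' V`
(`U' ≥ 0`), `Σ_S m(ρ)/γ ≤ Σ_{U'<γ≤V} m(ρ)/γ`. [folklore] -/
private theorem sum_inv_le_sum_inv_of_subset {U' V : ℝ} (hU' : 0 ≤ U') {S : Finset ℂ}
    (hS : S ⊆ zerosBetween U' V) :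
    ∑ ρ ∈ S, (riemannZetaZeroOrder ρ : ℝ) * (1 / ρ.im) ≤
      ∑ ρ ∈ zerosBetween U' V, (riemannZetaZeroOrder ρ : ℝ) * (1 / ρ.im) := by
  refine Finset.sum_le_sum_of_subset_of_nonneg hS fun ρ hρ _ ↦ ?_
  have hm := zeroOrder_nonneg_of_mem_zerosBetween hU' hρ
  obtain ⟨-, -, -, h3, -⟩ := (mem_zerosBetween hU').1 hρ
  have : 0 < ρ.im := hU'.trans_lt h3
  positivity

/-- **FKS Lemma 2.1** for the CLOSED window `U ≤ γ ≤ V` (which contains the printed `U ≤ γ < V`):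
if `|N(t) − L(t)| ≤ R(t)` for `t ≥ T₁` with `T₁ < U`, `b₁, b₂ ≥ 0`, `2π < U ≤ V`, then for every
tree window `(U₀, V]` (`U₀ ≥ 0`), the zeros `ρ` in it with `Im ρ ≥ U` satisfy
`Σ m(ρ)/γ ≤ B₁(U, V)`. (Printed: "`1 < U`", with `R` valid from `T = 2`; `B₁` involves
`log(U/2π)` in a denominator and is used in print only for `U ≥ 100`.) Proof: the window
`(U', V]`, `U' ↑ U`, contains these zeros, and `B₁(·,V)` is continuous.
[cite: FioriKadiriSwidinsky2023, Lemma 2.1] -/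
theorem FioriKadiriSwidinsky2023_lemma21 {b₁ b₂ b₃ T₁ U₀ U V : ℝ} (hb₁ : 0 ≤ b₁) (hb₂ : 0 ≤ b₂)
    (hR : ∀ t : ℝ, T₁ ≤ t → |(zetaZeroCount t : ℝ) - countMain t| ≤ FKS2023.countErr b₁ b₂ b₃ t)
    (hT₁ : T₁ < U) (hU₀ : 0 ≤ U₀) (hU : 2 * π < U) (hUV : U ≤ V) :
    ∑ ρ ∈ (zerosBetween U₀ V).filter (fun ρ ↦ U ≤ ρ.im), (riemannZetaZeroOrder ρ : ℝ) * (1 / ρ.im)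
      ≤ FKS2023.B₁ b₁ b₂ b₃ U V := by
  have hπ : 3 < π := Real.pi_gt_three
  have hV : 0 < V := by linarith
  set S := (zerosBetween U₀ V).filter (fun ρ ↦ U ≤ ρ.im) with hSdef
  -- for every U' ∈ (max T₁ 2π, U): Σ_S ≤ B₁(U', V)
  have hbound : ∀ U' ∈ Ioo (max T₁ (2 * π)) U,
      ∑ ρ ∈ S, (riemannZetaZeroOrder ρ : ℝ) * (1 / ρ.im) ≤ FKS2023.B₁ b₁ b₂ b₃ U' V := by
    intro U' hU'
    obtain ⟨h1, h2⟩ := hU'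
    have hT₁' : T₁ < U' := (le_max_left _ _).trans_lt h1
    have h2π' : 2 * π < U' := (le_max_right _ _).trans_lt h1
    have hU'0 : 0 ≤ U' := by linarith
    have hsub : S ⊆ zerosBetween U' V := by
      intro ρ hρ
      rw [hSdef, Finset.mem_filter, mem_zerosBetween hU₀] at hρ
      obtain ⟨⟨hz, ha, hb, -, hd⟩, hU'⟩ := hρ
      exact (mem_zerosBetween hU'0).2 ⟨hz, ha, hb, by linarith, hd⟩
    refine (sum_inv_le_sum_inv_of_subset hU'0 hsub).trans ?_
    exact sum_inv_le_B₁_of_count hb₁ hb₂ h2π' (h2.le.trans hUV)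
      fun t ht ↦ hR t (hT₁'.le.trans ht.1)
  -- let U' ↑ U
  have hcont := (FKS2023.continuousAt_B₁ (b₁ := b₁) (b₂ := b₂) (b₃ := b₃) hU hV).tendsto
  have hlt : max T₁ (2 * π) < U := max_lt hT₁ hU
  have hev : ∀ᶠ U' in 𝓝[<] U,
      ∑ ρ ∈ S, (riemannZetaZeroOrder ρ : ℝ) * (1 / ρ.im) ≤ FKS2023.B₁ b₁ b₂ b₃ U' V :=
    mem_of_superset (Ioo_mem_nhdsLT hlt) hbound
  exact ge_of_tendsto (hcont.mono_left nhdsWithin_le_nhds) hev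

/-- **There is a gap below every height**: for `0 ≤ L < U` there is `U' ∈ (L, U)` such that no zero
of `ζ` in the closed critical strip has ordinate in `(U', U)` (the zeros below `U` are finitely
many, Titchmarsh §9.2). [cite: Titchmarsh1986, §9.2] -/
theorem exists_noOrdinate_Ioo {L U : ℝ} (hL : 0 ≤ L) (hLU : L < U) :
    ∃ U' ∈ Ioo L U, ∀ ρ : ℂ, riemannZeta ρ = 0 → 0 ≤ ρ.re → ρ.re ≤ 1 →
      U' < ρ.im → ρ.im < U → False := by
  classical
  set A : Finset ℝ := ((zetaZeroBox_finite 0 U).toFinset.filter (fun ρ ↦ ρ.im < U)).image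
    Complex.im with hA
  set m : ℝ := (insert L A).max' (Finset.insert_nonempty _ _) with hm
  have hmU : m < U := by
    refine (Finset.max'_lt_iff _ _).2 fun x hx ↦ ?_
    rcases Finset.mem_insert.1 hx with rfl | hx
    · exact hLU
    · obtain ⟨ρ, hρ, rfl⟩ := Finset.mem_image.1 hx
      exact (Finset.mem_filter.1 hρ).2
  have hLm : L ≤ m := Finset.le_max' _ _ (Finset.mem_insert_self _ _)
  refine ⟨(m + U) / 2, ⟨by linarith, by linarith⟩, fun ρ hz h0 h1 hlo hhi ↦ ?_⟩
  have hmem : ρ.im ∈ insert L A := by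
    refine Finset.mem_insert_of_mem (Finset.mem_image.2 ⟨ρ, ?_, rfl⟩)
    refine Finset.mem_filter.2 ⟨(Set.Finite.mem_toFinset _).2 ⟨hz, h0, h1, ?_, hhi.le⟩, hhi⟩
    linarith
  have := Finset.le_max' _ _ hmem
  linarith

/-! ## Table 1 (named fact) and Corollary 2.3 -/

/-- NAMED FACT (**Fiori–Kadiri–Swidinsky 2023, Table 1 with eq. (2.4)**, as printed: "Each row
in Table 1 represents a strict upper bound for the numerical evaluation of
`S₀ − 10⁻¹⁰ < Σ_{0<γ<T₀} 1/γ < S₀`. We use the zeros as computed by Platt [Pla17] and made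
available through LMFDB"): for each of the ten printed rows `(T₀, S₀) ∈ FKS2023.recipZeroTable2`
(`T₀ = 10², …, 10¹⁰, 30 610 046 000`), the sum of `1/γ` over the zeros with `0 < γ < T₀`
(with multiplicity) lies in `(S₀ − 10⁻¹⁰, S₀)` — rendered as: every truncation `0 < γ ≤ T`,
`T < T₀`, is `< S₀`, and some such truncation is `> S₀ − 10⁻¹⁰`. Part computational (Platt's
rigorous isolation of the zeros below `3·10¹⁰`). The rows `T₀ = 100, 1000` are theorems of the tree
(`ZetaZeroReciprocalSumsTable2Low.lean`). Users take `(h : FioriKadiriSwidinsky2023_table2)`.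
[cite: FioriKadiriSwidinsky2023, Table 1 and eq. (2.4)] -/
def FioriKadiriSwidinsky2023_table2 : Prop :=
  ∀ T₀ S₀ : ℝ, (T₀, S₀) ∈ FKS2023.recipZeroTable2 →
    (∀ T : ℝ, T < T₀ →
        ∑ ρ ∈ zerosBetween 0 T, (riemannZetaZeroOrder ρ : ℝ) * (1 / ρ.im) < S₀) ∧
      ∃ T : ℝ, T < T₀ ∧
        S₀ - 1e-10 < ∑ ρ ∈ zerosBetween 0 T, (riemannZetaZeroOrder ρ : ℝ) * (1 / ρ.im)

/-- Every `T₀` of Table 1 is at least `100`. [cite: FioriKadiriSwidinsky2023, Table 1] -/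
theorem FKS2023.hundred_le_of_mem_recipZeroTable2 {T₀ S₀ : ℝ}
    (h : (T₀, S₀) ∈ FKS2023.recipZeroTable2) : 100 ≤ T₀ := by
  simp only [FKS2023.recipZeroTable2, List.mem_cons, Prod.mk.injEq, List.not_mem_nil,
    or_false] at h
  rcases h with ⟨rfl, -⟩ | ⟨rfl, -⟩ | ⟨rfl, -⟩ | ⟨rfl, -⟩ | ⟨rfl, -⟩ | ⟨rfl, -⟩ | ⟨rfl, -⟩ |
    ⟨rfl, -⟩ | ⟨rfl, -⟩ | ⟨rfl, -⟩ <;> norm_num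

/-- **FKS Corollary 2.3** (PROVED from Table 1 and Lemma 2.1): if `|N(t) − L(t)| ≤ R(t) =
b₁ log t + b₂ log log t + b₃` for `t ≥ 2` (`b₁, b₂ ≥ 0`; Remark 2.2: Rosser's or
Hasanalizade–Shen–Wong's constants), then for each row `(T₀, S₀)` of Table 1 and every `V ≥ T₀`,
`Σ_{0<γ≤V} m(ρ)/γ < S₀ + B₁(T₀, V)` (printed for `Σ_{0<γ<V}`, `V > T₀`; the closed sum is larger).
[cite: FioriKadiriSwidinsky2023, Cor. 2.3] -/
theorem FioriKadiriSwidinsky2023_cor23 (h : FioriKadiriSwidinsky2023_table2) {b₁ b₂ b₃ : ℝ}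
    (hb₁ : 0 ≤ b₁) (hb₂ : 0 ≤ b₂)
    (hR : ∀ t : ℝ, 2 ≤ t → |(zetaZeroCount t : ℝ) - countMain t| ≤ FKS2023.countErr b₁ b₂ b₃ t)
    {T₀ S₀ : ℝ} (hrow : (T₀, S₀) ∈ FKS2023.recipZeroTable2) {V : ℝ} (hV : T₀ ≤ V) :
    ∑ ρ ∈ zerosBetween 0 V, (riemannZetaZeroOrder ρ : ℝ) * (1 / ρ.im) <
      S₀ + FKS2023.B₁ b₁ b₂ b₃ T₀ V := by
  classical
  have hπ : π < 3.15 := Real.pi_lt_d2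
  have hπ3 : 3 < π := Real.pi_gt_three
  have hT₀ := FKS2023.hundred_le_of_mem_recipZeroTable2 hrow
  have h2πT₀ : 2 * π < T₀ := by linarith
  have hV0 : 0 < V := by linarith
  obtain ⟨hup, -⟩ := h T₀ S₀ hrow
  -- a gap (U', T₀) free of ordinates, with U' > 2π
  obtain ⟨U', ⟨hU'1, hU'2⟩, hgap⟩ := exists_noOrdinate_Ioo (L := 2 * π) (by positivity) h2πT₀
  have hU'0 : 0 ≤ U' := by linarith
  -- for T ∈ (U', T₀): split at T; the lower part is constant (= the part below any fixed T*)
  set T₁ : ℝ := (U' + T₀) / 2 with hT₁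
  have hT₁lo : U' < T₁ := by rw [hT₁]; linarith
  have hT₁hi : T₁ < T₀ := by rw [hT₁]; linarith
  have hlow_eq : ∀ T ∈ Ioo U' T₀, zerosBetween 0 T = zerosBetween 0 T₁ := by
    intro T hT
    ext ρ
    rw [mem_zerosBetween le_rfl, mem_zerosBetween le_rfl]
    constructor
    · rintro ⟨hz, ha, hb, hc, hd⟩
      refine ⟨hz, ha, hb, hc, ?_⟩
      by_contra hlt
      exact hgap ρ hz ha hb (hT₁lo.trans (not_le.1 hlt)) (hd.trans_lt hT.2)
    · rintro ⟨hz, ha, hb, hc, hd⟩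
      refine ⟨hz, ha, hb, hc, ?_⟩
      by_contra hlt
      exact hgap ρ hz ha hb (hT.1.trans (not_le.1 hlt)) (hd.trans_lt hT₁hi)
  have hlow : ∑ ρ ∈ zerosBetween 0 T₁, (riemannZetaZeroOrder ρ : ℝ) * (1 / ρ.im) < S₀ :=
    hup T₁ hT₁hi
  -- the bound for every T ∈ (U', T₀)
  have hbound : ∀ T ∈ Ioo U' T₀,
      ∑ ρ ∈ zerosBetween 0 V, (riemannZetaZeroOrder ρ : ℝ) * (1 / ρ.im) ≤
        ∑ ρ ∈ zerosBetween 0 T₁, (riemannZetaZeroOrder ρ : ℝ) * (1 / ρ.im)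
          + FKS2023.B₁ b₁ b₂ b₃ T V := by
    intro T hT
    have hT0 : 0 ≤ T := hU'0.trans hT.1.le
    have hTV : T ≤ V := hT.2.le.trans hV
    have h2πT : 2 * π < T := hU'1.trans hT.1
    rw [SoundTest.sum_zerosBetween_split le_rfl hT0 hTV
      (fun ρ ↦ (riemannZetaZeroOrder ρ : ℝ) * (1 / ρ.im)), hlow_eq T hT]
    have hmid : ∑ ρ ∈ zerosBetween T V, (riemannZetaZeroOrder ρ : ℝ) * (1 / ρ.im) ≤
        FKS2023.B₁ b₁ b₂ b₃ T V :=
      sum_inv_le_B₁_of_count hb₁ hb₂ h2πT hTV fun t ht ↦ hR t (by linarith [ht.1])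
    linarith
  -- let T ↑ T₀
  have hcont := (FKS2023.continuousAt_B₁ (b₁ := b₁) (b₂ := b₂) (b₃ := b₃) h2πT₀ hV0).tendsto
  have hev : ∀ᶠ T in 𝓝[<] T₀,
      ∑ ρ ∈ zerosBetween 0 V, (riemannZetaZeroOrder ρ : ℝ) * (1 / ρ.im) ≤
        ∑ ρ ∈ zerosBetween 0 T₁, (riemannZetaZeroOrder ρ : ℝ) * (1 / ρ.im)
          + FKS2023.B₁ b₁ b₂ b₃ T V :=
    mem_of_superset (Ioo_mem_nhdsLT hU'2) hbound
  have hlim : Tendsto (fun T ↦ ∑ ρ ∈ zerosBetween 0 T₁, (riemannZetaZeroOrder ρ : ℝ) * (1 / ρ.im)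
      + FKS2023.B₁ b₁ b₂ b₃ T V) (𝓝[<] T₀)
      (𝓝 (∑ ρ ∈ zerosBetween 0 T₁, (riemannZetaZeroOrder ρ : ℝ) * (1 / ρ.im)
        + FKS2023.B₁ b₁ b₂ b₃ T₀ V)) :=
    (tendsto_const_nhds.add hcont).mono_left nhdsWithin_le_nhds
  have hle := ge_of_tendsto hlim hev
  linarith

/-! ## The upper incomplete Gamma function: calculus -/

/-- The integrand `t^{s−1} e^{−t}` is integrable on `(x, ∞)` for `s > 0`, `x ≥ 0` (Mathlib's
convergence of the Euler integral; the integral 8.2.2 converges). [cite: DLMF, §8.2 eq. 8.2.2] -/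
theorem integrableOn_upperIncGamma_integrand {s x : ℝ} (hs : 0 < s) (hx : 0 ≤ x) :
    IntegrableOn (fun t : ℝ ↦ t ^ (s - 1) * Real.exp (-t)) (Ioi x) := by
  have h := (Real.GammaIntegral_convergent hs).mono_set (Ioi_subset_Ioi hx)
  exact h.congr_fun (fun t _ ↦ mul_comm _ _) measurableSet_Ioi

/-- `Γ(s, A) − Γ(s, B) = ∫_A^B t^{s−1} e^{−t} dt` for `0 ≤ A ≤ B`, `s > 0` (additivity of the
integral 8.2.2). [cite: DLMF, §8.2 eq. 8.2.2] -/
theorem upperIncGamma_sub {s A B : ℝ} (hs : 0 < s) (hA : 0 ≤ A) (hAB : A ≤ B) :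
    upperIncGamma s A - upperIncGamma s B = ∫ t in A..B, t ^ (s - 1) * Real.exp (-t) := by
  unfold upperIncGamma
  exact intervalIntegral.integral_Ioi_sub_Ioi (integrableOn_upperIncGamma_integrand hs hA) hAB

/-- **`d/dx Γ(s, x) = −x^{s−1} e^{−x}`** for `s > 0`, `x > 0`. [cite: DLMF, §8.8 eq. 8.8.13] -/
theorem hasDerivAt_upperIncGamma {s x : ℝ} (hs : 0 < s) (hx : 0 < x) :
    HasDerivAt (upperIncGamma s) (-(x ^ (s - 1) * Real.exp (-x))) x := by
  set g : ℝ → ℝ := fun t ↦ t ^ (s - 1) * Real.exp (-t) with hg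
  have hc : 0 < x / 2 := by positivity
  have hgc : ∀ t, 0 < t → ContinuousAt g t := fun t ht ↦
    (Real.continuousAt_rpow_const _ _ (Or.inl ht.ne')).mul
      (Real.continuous_exp.comp continuous_neg).continuousAt
  -- near `x`, `Γ(s, y) = Γ(s, x/2) − ∫_{x/2}^y g`
  have hev : (upperIncGamma s) =ᶠ[𝓝 x] fun y ↦ upperIncGamma s (x / 2) - ∫ t in (x / 2)..y, g t := by
    filter_upwards [Ioi_mem_nhds (show x / 2 < x by linarith)] with y hy
    have := upperIncGamma_sub hs hc.le (le_of_lt hy)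
    simp only [hg]
    linarith
  have hint : IntervalIntegrable g volume (x / 2) x := by
    refine ContinuousOn.intervalIntegrable_of_Icc (by linarith) fun t ht ↦ ?_
    exact (hgc t (hc.trans_le ht.1)).continuousWithinAt
  have hmeas : StronglyMeasurableAtFilter g (𝓝 x) := by
    have hco : ContinuousOn g (Ioi 0) := fun t ht ↦ (hgc t ht).continuousWithinAt
    exact hco.stronglyMeasurableAtFilter isOpen_Ioi x hx
  have hD : HasDerivAt (fun y ↦ ∫ t in (x / 2)..y, g t) (g x) x :=
    intervalIntegral.integral_hasDerivAt_right hint hmeas (hgc x hx)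
  have hD' : HasDerivAt (fun y ↦ upperIncGamma s (x / 2) - ∫ t in (x / 2)..y, g t) (-(g x)) x := by
    simpa using hD.const_sub (upperIncGamma s (x / 2))
  exact hD'.congr_of_eventuallyEq hev

/-- `Γ(s, ·)` is continuous at every `x > 0` (`s > 0`), being differentiable there.
[cite: DLMF, §8.8 eq. 8.8.13] -/
theorem continuousAt_upperIncGamma {s x : ℝ} (hs : 0 < s) (hx : 0 < x) :
    ContinuousAt (upperIncGamma s) x :=
  (hasDerivAt_upperIncGamma hs hx).continuousAt

/-- **The `J`-integrals in closed form** (proof of Lemma 2.5: "`J_{a,b}(T) = ∫_T^∞ (log y)^a y^{−b} dy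
= Γ(a+1, (b−1) log T)/(b−1)^{a+1}`, doing the variable change `y = e^{t/(b−1)}`"), in the finite
form used: for `a ≥ 0`, `b > 1`, `1 < U ≤ V`,
`∫_U^V (log y)^a / y^b dy = (Γ(a+1,(b−1)log U) − Γ(a+1,(b−1)log V))/(b−1)^{a+1}` (real powers).
[cite: FioriKadiriSwidinsky2023, Lemma 2.5 (proof, eq. (2.11))] -/
theorem integral_log_rpow_div_rpow {a b U V : ℝ} (ha : 0 ≤ a) (hb : 1 < b) (hU : 1 < U)
    (hUV : U ≤ V) :
    ∫ y in U..V, Real.log y ^ a / y ^ b =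
      (upperIncGamma (a + 1) ((b - 1) * Real.log U) - upperIncGamma (a + 1) ((b - 1) * Real.log V))
        / (b - 1) ^ (a + 1) := by
  set κ : ℝ := b - 1 with hκ
  have hκ0 : 0 < κ := by rw [hκ]; linarith
  have hIcc : uIcc U V = Icc U V := uIcc_of_le hUV
  have hlogU : 0 < Real.log U := Real.log_pos hU
  -- the substitution `t = κ log y`
  set f : ℝ → ℝ := fun y ↦ κ * Real.log y with hf
  set g : ℝ → ℝ := fun t ↦ t ^ (a + 1 - 1) * Real.exp (-t) with hg
  have hfd : ∀ y ∈ uIcc U V, HasDerivAt f (κ * y⁻¹) y := by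
    intro y hy
    rw [hIcc] at hy
    have hy0 : 0 < y := by linarith [hy.1]
    exact (Real.hasDerivAt_log hy0.ne').const_mul κ
  have hf'c : ContinuousOn (fun y : ℝ ↦ κ * y⁻¹) (uIcc U V) := by
    rw [hIcc]
    intro y hy
    have hy0 : 0 < y := by linarith [hy.1]
    exact (continuousAt_const.mul (continuousAt_inv₀ hy0.ne')).continuousWithinAt
  have hgc : ContinuousOn g (f '' uIcc U V) := by
    rintro t ⟨y, hy, rfl⟩
    rw [hIcc] at hy
    have hy1 : 1 < y := hU.trans_le hy.1
    have ht : 0 < κ * Real.log y := mul_pos hκ0 (Real.log_pos hy1)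
    exact ((Real.continuousAt_rpow_const _ _ (Or.inl ht.ne')).mul
      (Real.continuous_exp.comp continuous_neg).continuousAt).continuousWithinAt
  have hsub := intervalIntegral.integral_comp_mul_deriv' hfd hf'c hgc
  -- pointwise: (g ∘ f) y * f' y = κ^{a+1} (log y)^a / y^b
  have hpt : ∀ y ∈ uIcc U V, (g ∘ f) y * (κ * y⁻¹) = κ ^ (a + 1) * (Real.log y ^ a / y ^ b) := by
    intro y hy
    rw [hIcc] at hy
    have hy0 : 0 < y := by linarith [hy.1]
    have hly : 0 < Real.log y := Real.log_pos (hU.trans_le hy.1)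
    simp only [Function.comp, hg, hf, add_sub_cancel_right]
    rw [Real.mul_rpow hκ0.le hly.le]
    have e1 : Real.exp (-(κ * Real.log y)) = y ^ (-κ) := by
      rw [Real.rpow_def_of_pos hy0]; ring_nf
    have e2 : y ^ b = y ^ κ * y := by
      rw [show b = κ + 1 by rw [hκ]; ring, Real.rpow_add hy0, Real.rpow_one]
    have e3 : κ ^ (a + 1) = κ ^ a * κ := by rw [Real.rpow_add hκ0, Real.rpow_one]
    rw [e1, e2, e3, Real.rpow_neg hy0.le]
    have hyκ : 0 < y ^ κ := Real.rpow_pos_of_pos hy0 κ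
    field_simp
  have hlhs : ∫ y in U..V, (g ∘ f) y * (κ * y⁻¹) = κ ^ (a + 1) * ∫ y in U..V, Real.log y ^ a / y ^ b := by
    rw [← intervalIntegral.integral_const_mul]
    exact intervalIntegral.integral_congr hpt
  -- the right-hand side is a difference of incomplete Gamma values
  have hA : 0 ≤ κ * Real.log U := by positivity
  have hAB : κ * Real.log U ≤ κ * Real.log V :=
    mul_le_mul_of_nonneg_left (Real.log_le_log (by linarith) hUV) hκ0.le
  have hrhs : ∫ t in f U..f V, g t =
      upperIncGamma (a + 1) (κ * Real.log U) - upperIncGamma (a + 1) (κ * Real.log V) := by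
    rw [upperIncGamma_sub (by linarith) hA hAB]
  rw [hlhs, hrhs] at hsub
  have hκa : 0 < κ ^ (a + 1) := Real.rpow_pos_of_pos hκ0 _
  rw [eq_div_iff hκa.ne', mul_comm]
  exact hsub

/-- **Remark 2.6**: `Γ(3, x) = (x² + 2(x+1)) e^{−x}` (`x ≥ 0`; DLMF 8.4.8: `Γ(n+1,z) = n! e^{−z} e_n(z)`).
[cite: FioriKadiriSwidinsky2023, Remark 2.6 eq. (2.12)] [cite: DLMF, §8.4 eq. 8.4.8] -/
theorem upperIncGamma_three {x : ℝ} (hx : 0 ≤ x) :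
    upperIncGamma 3 x = (x ^ 2 + 2 * (x + 1)) * Real.exp (-x) := by
  unfold upperIncGamma
  set F : ℝ → ℝ := fun t ↦ -((t ^ 2 + 2 * (t + 1)) * Real.exp (-t)) with hF
  have hderiv : ∀ t ∈ Ioi x, HasDerivAt F (t ^ (3 - 1 : ℝ) * Real.exp (-t)) t := by
    intro t ht
    have ht0 : 0 < t := hx.trans_lt ht
    have ha : HasDerivAt (fun t : ℝ ↦ t ^ 2) (2 * t) t := by simpa using hasDerivAt_pow 2 t
    have hb : HasDerivAt (fun t : ℝ ↦ 2 * (t + 1)) (2 * 1) t :=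
      ((hasDerivAt_id' t).add_const 1).const_mul 2
    have h1 : HasDerivAt (fun t : ℝ ↦ t ^ 2 + 2 * (t + 1)) (2 * t + 2 * 1) t := ha.add hb
    have h2 : HasDerivAt (fun t : ℝ ↦ Real.exp (-t)) (Real.exp (-t) * -1) t :=
      (Real.hasDerivAt_exp (-t)).comp t (hasDerivAt_neg t)
    have h : HasDerivAt F (-((2 * t + 2 * 1) * Real.exp (-t) + (t ^ 2 + 2 * (t + 1)) *
        (Real.exp (-t) * -1))) t := (h1.mul h2).neg
    have e : t ^ (3 - 1 : ℝ) = t ^ 2 := by norm_num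
    rw [e]
    refine h.congr_deriv ?_
    ring
  have hcont : ContinuousWithinAt F (Ici x) x := by
    refine Continuous.continuousWithinAt ?_
    exact (((continuous_pow 2).add (continuous_const.mul (continuous_id.add continuous_const))).mul
      (Real.continuous_exp.comp continuous_neg)).neg
  have hint : IntegrableOn (fun t : ℝ ↦ t ^ (3 - 1 : ℝ) * Real.exp (-t)) (Ioi x) :=
    integrableOn_upperIncGamma_integrand (by norm_num) hx
  have hlim : Tendsto F atTop (𝓝 0) := by
    have h2 := Real.tendsto_pow_mul_exp_neg_atTop_nhds_zero 2
    have h1 := Real.tendsto_pow_mul_exp_neg_atTop_nhds_zero 1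
    have h0 := Real.tendsto_pow_mul_exp_neg_atTop_nhds_zero 0
    have h := (h2.add ((h1.add h0).const_mul 2)).neg
    simp only [add_zero, mul_zero, neg_zero] at h
    refine h.congr' (Eventually.of_forall fun t ↦ ?_)
    simp only [hF, pow_one, pow_zero]
    ring
  rw [integral_Ioi_of_hasDerivAt_of_tendsto hcont hderiv hint hlim]
  simp only [hF]
  ring

/-! ## Lemma 2.5: `s₀(σ,U,V) ≤ B₀(σ,U,V)` from a (ZDB) majorant -/

/-- The zeros of `ζ` with `σ ≤ Re ρ ≤ 1` and `U < Im ρ ≤ V` (each listed once; weights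
`m(ρ) = riemannZetaZeroOrder ρ`): the finite set `box(σ,V) ∖ box(σ,U)` of the tree's
`zetaZeroCountRe`-boxes (FKS's `σ ≤ β < 1`, `U ≤ γ < V` up to the endpoint conventions discussed
in the module docstring). [cite: FioriKadiriSwidinsky2023, §2.2 eq. (2.6) (the sum s₀)] -/
def zerosBetweenRe (σ U V : ℝ) : Finset ℂ :=
  (zetaZeroBox_finite σ V).toFinset \ (zetaZeroBox_finite σ U).toFinset

/-- Membership in `zerosBetweenRe σ U V` (`0 ≤ U`): `ζ(ρ) = 0`, `σ ≤ Re ρ ≤ 1`, `U < Im ρ ≤ V`.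
[cite: Titchmarsh1986, §9.1] -/
theorem mem_zerosBetweenRe {σ U V : ℝ} (hU : 0 ≤ U) {ρ : ℂ} :
    ρ ∈ zerosBetweenRe σ U V ↔
      riemannZeta ρ = 0 ∧ σ ≤ ρ.re ∧ ρ.re ≤ 1 ∧ U < ρ.im ∧ ρ.im ≤ V := by
  unfold zerosBetweenRe
  rw [Finset.mem_sdiff, Set.Finite.mem_toFinset, Set.Finite.mem_toFinset]
  simp only [zetaZeroBox, Set.mem_setOf_eq]
  constructor
  · rintro ⟨⟨hz, h1, h2, h3, h4⟩, hn⟩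
    refine ⟨hz, h1, h2, ?_, h4⟩
    by_contra hle
    exact hn ⟨hz, h1, h2, h3, not_lt.1 hle⟩
  · rintro ⟨hz, h1, h2, h3, h4⟩
    exact ⟨⟨hz, h1, h2, hU.trans_lt h3, h4⟩, fun h ↦ absurd h.2.2.2.2 (not_le.2 h3)⟩

/-- `N(σ,V) − N(σ,U) = Σ_{zerosBetweenRe σ U V} m(ρ)` (`U ≤ V`). [cite: Titchmarsh1986, §9.1] -/
theorem zetaZeroCountRe_sub_eq_sum_zerosBetweenRe (σ : ℝ) {U V : ℝ} (hUV : U ≤ V) :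
    ((zetaZeroCountRe σ V : ℝ) - zetaZeroCountRe σ U) =
      ∑ ρ ∈ zerosBetweenRe σ U V, (riemannZetaZeroOrder ρ : ℝ) :=
  zetaZeroCountRe_sub_eq_sum σ hUV

/-- The partial counts inside `(U, V]`: for `U ≤ t ≤ V`,
`Σ_{ρ ∈ zerosBetweenRe σ U V, Im ρ ≤ t} m(ρ) = N(σ,t) − N(σ,U)`. [cite: Titchmarsh1986, §9.1] -/
theorem sum_indicator_eq_countRe_sub {σ U V t : ℝ} (hU : 0 ≤ U) (h1 : U ≤ t) (h2 : t ≤ V) :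
    ∑ ρ ∈ zerosBetweenRe σ U V, (riemannZetaZeroOrder ρ : ℝ) * (if ρ.im ≤ t then 1 else 0) =
      (zetaZeroCountRe σ t : ℝ) - zetaZeroCountRe σ U := by
  classical
  rw [zetaZeroCountRe_sub_eq_sum_zerosBetweenRe σ h1]
  have hfilter : (zerosBetweenRe σ U V).filter (fun ρ ↦ ρ.im ≤ t) = zerosBetweenRe σ U t := by
    ext ρ
    simp only [Finset.mem_filter, mem_zerosBetweenRe hU]
    constructor
    · rintro ⟨⟨hz, ha, hb, hc, -⟩, ht⟩; exact ⟨hz, ha, hb, hc, ht⟩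
    · rintro ⟨hz, ha, hb, hc, ht⟩; exact ⟨⟨hz, ha, hb, hc, ht.trans h2⟩, ht⟩
  rw [← hfilter, Finset.sum_filter]
  refine Finset.sum_congr rfl fun ρ _ ↦ ?_
  split_ifs <;> simp

/-- **Partial summation of a zero sum against `N(σ, t)`** (the Stieltjes integration by parts of
the proof of Lemma 2.5; `σ`-restricted twin of the tree's `SchoenfeldBound.sum_zerosBetween_eq`):
for `0 ≤ U ≤ V` and `f ∈ C¹[U, V]`,
`Σ_{U<γ≤V, β≥σ} m(ρ) f(γ) = (N(σ,V) − N(σ,U)) f(V) − ∫_U^V (N(σ,t) − N(σ,U)) f'(t) dt`.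
[cite: FioriKadiriSwidinsky2023, Lemma 2.5 (proof, first display)] -/
theorem sum_zerosBetweenRe_eq {σ U V : ℝ} (hU : 0 ≤ U) (hUV : U ≤ V) {f f' : ℝ → ℝ}
    (hf : ∀ t ∈ Icc U V, HasDerivAt f (f' t) t) (hf' : ContinuousOn f' (Icc U V)) :
    ∑ ρ ∈ zerosBetweenRe σ U V, (riemannZetaZeroOrder ρ : ℝ) * f ρ.im =
      ((zetaZeroCountRe σ V : ℝ) - zetaZeroCountRe σ U) * f V -
        ∫ t in U..V, ((zetaZeroCountRe σ t : ℝ) - zetaZeroCountRe σ U) * f' t := by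
  classical
  have hone : ∀ ρ ∈ zerosBetweenRe σ U V, f ρ.im =
      f V - ∫ t in U..V, (if ρ.im ≤ t then (1 : ℝ) else 0) * f' t := by
    intro ρ hρ
    obtain ⟨-, -, -, h3, h4⟩ := (mem_zerosBetweenRe hU).1 hρ
    rw [integral_indicator_mul_eq h3 h4 hf']
    have hderiv : ∀ t ∈ uIcc ρ.im V, HasDerivAt f (f' t) t := fun t ht ↦ by
      rw [uIcc_of_le h4] at ht
      exact hf t ⟨h3.le.trans ht.1, ht.2⟩
    have hint : IntervalIntegrable f' volume ρ.im V :=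
      (hf'.mono (Icc_subset_Icc h3.le le_rfl)).intervalIntegrable_of_Icc h4
    rw [integral_eq_sub_of_hasDerivAt hderiv hint]
    ring
  have hint : ∀ ρ ∈ zerosBetweenRe σ U V, IntervalIntegrable
      (fun t ↦ (riemannZetaZeroOrder ρ : ℝ) * ((if ρ.im ≤ t then (1 : ℝ) else 0) * f' t)) volume U V := by
    intro ρ _
    have hg' : IntegrableOn f' (Ioc U V) volume := hf'.integrableOn_Icc.mono_set Ioc_subset_Icc_self
    have heq : (fun t ↦ (if ρ.im ≤ t then (1 : ℝ) else 0) * f' t) = (Ici ρ.im).indicator f' := by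
      funext t
      by_cases h : ρ.im ≤ t
      · rw [if_pos h, one_mul, Set.indicator_of_mem (show t ∈ Ici ρ.im from h)]
      · rw [if_neg h, zero_mul, Set.indicator_of_notMem (show t ∉ Ici ρ.im from h)]
    refine IntervalIntegrable.const_mul ?_ _
    rw [intervalIntegrable_iff_integrableOn_Ioc_of_le hUV, heq]
    exact hg'.indicator measurableSet_Ici
  calc ∑ ρ ∈ zerosBetweenRe σ U V, (riemannZetaZeroOrder ρ : ℝ) * f ρ.im
      = ∑ ρ ∈ zerosBetweenRe σ U V, ((riemannZetaZeroOrder ρ : ℝ) * f V -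
          ∫ t in U..V, (riemannZetaZeroOrder ρ : ℝ) * ((if ρ.im ≤ t then (1 : ℝ) else 0) * f' t)) := by
        refine Finset.sum_congr rfl fun ρ hρ ↦ ?_
        rw [hone ρ hρ, intervalIntegral.integral_const_mul]
        ring
    _ = (∑ ρ ∈ zerosBetweenRe σ U V, (riemannZetaZeroOrder ρ : ℝ)) * f V -
          ∫ t in U..V, ∑ ρ ∈ zerosBetweenRe σ U V,
            (riemannZetaZeroOrder ρ : ℝ) * ((if ρ.im ≤ t then (1 : ℝ) else 0) * f' t) := by
        rw [Finset.sum_sub_distrib, Finset.sum_mul, intervalIntegral.integral_finsetSum hint]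
    _ = ((zetaZeroCountRe σ V : ℝ) - zetaZeroCountRe σ U) * f V -
          ∫ t in U..V, ((zetaZeroCountRe σ t : ℝ) - zetaZeroCountRe σ U) * f' t := by
        rw [← zetaZeroCountRe_sub_eq_sum_zerosBetweenRe σ hUV]
        congr 1
        refine intervalIntegral.integral_congr fun t ht ↦ ?_
        rw [uIcc_of_le hUV] at ht
        rw [← sum_indicator_eq_countRe_sub hU ht.1 ht.2, Finset.sum_mul]
        refine Finset.sum_congr rfl fun ρ _ ↦ ?_
        ring

/-- `t ↦ N(σ,t) − N(σ,U)` times a continuous function is interval integrable (`N(σ,·)` is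
monotone). [cite: Titchmarsh1986, §9.1] -/
theorem intervalIntegrable_countRe_sub_mul {σ U a b : ℝ} {g : ℝ → ℝ}
    (hg : ContinuousOn g (uIcc a b)) :
    IntervalIntegrable (fun t ↦ ((zetaZeroCountRe σ t : ℝ) - zetaZeroCountRe σ U) * g t)
      volume a b := by
  have hmono : Monotone fun t ↦ ((zetaZeroCountRe σ t : ℝ) - zetaZeroCountRe σ U) := by
    intro s t hst
    have := zetaZeroCountRe_mono_right_holds σ hst
    simp only [sub_le_sub_iff_right, Nat.cast_le, this]
  exact hmono.intervalIntegrable.mul_continuousOn hg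

/-- **Upper bound from `N(σ,·) ≤ Ñ`** (proof of Lemma 2.5, "use the bound `N ≤ Ñ`"): for
`0 ≤ U ≤ V`, `f ∈ C¹[U,V]` non-increasing with `f(V) ≥ 0`, and `N(σ,t) ≤ Ñ(t)` on `[U,V]` with `Ñ`
continuous, `Σ_{U<γ≤V, β≥σ} m(ρ) f(γ) ≤ Ñ(V) f(V) + ∫_U^V Ñ(t) (−f'(t)) dt`.
[cite: FioriKadiriSwidinsky2023, Lemma 2.5 (proof)] -/
theorem sum_zerosBetweenRe_le_of_countRe_le {σ U V : ℝ} (hU : 0 ≤ U) (hUV : U ≤ V)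
    {f f' Nup : ℝ → ℝ} (hf : ∀ t ∈ Icc U V, HasDerivAt f (f' t) t)
    (hf' : ContinuousOn f' (Icc U V)) (hf'0 : ∀ t ∈ Icc U V, f' t ≤ 0) (hfV : 0 ≤ f V)
    (hN : ∀ t ∈ Icc U V, (zetaZeroCountRe σ t : ℝ) ≤ Nup t) (hNc : ContinuousOn Nup (Icc U V)) :
    ∑ ρ ∈ zerosBetweenRe σ U V, (riemannZetaZeroOrder ρ : ℝ) * f ρ.im ≤
      Nup V * f V + ∫ t in U..V, Nup t * (-f' t) := by
  rw [sum_zerosBetweenRe_eq hU hUV hf hf']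
  have hIcc : uIcc U V = Icc U V := uIcc_of_le hUV
  have hN0 : (0 : ℝ) ≤ zetaZeroCountRe σ U := Nat.cast_nonneg _
  have h1 : ((zetaZeroCountRe σ V : ℝ) - zetaZeroCountRe σ U) * f V ≤ Nup V * f V :=
    mul_le_mul_of_nonneg_right (by linarith [hN V ⟨hUV, le_rfl⟩]) hfV
  have h2 : -∫ t in U..V, ((zetaZeroCountRe σ t : ℝ) - zetaZeroCountRe σ U) * f' t ≤
      ∫ t in U..V, Nup t * (-f' t) := by
    rw [← intervalIntegral.integral_neg]
    refine intervalIntegral.integral_mono_on hUV ?_ ?_ fun t ht ↦ ?_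
    · exact (intervalIntegrable_countRe_sub_mul (by rw [hIcc]; exact hf')).neg
    · exact (hNc.mul hf'.neg).intervalIntegrable_of_Icc hUV
    · have := hN t ht
      have := hf'0 t ht
      have : (zetaZeroCountRe σ U : ℝ) ≤ zetaZeroCountRe σ t := by
        exact_mod_cast zetaZeroCountRe_mono_right_holds σ ht.1
      nlinarith
  linarith

/-- **FKS Lemma 2.5 in the tree's window convention.** If `N(σ,T) ≤ Ñ(T) = c₁ T^p (log T)^q +
c₂ (log T)²` for all `T ≥ T₀` (`T₀ ≥ 2`, `0 < p < 1`, `q > 0`), then for `T₀ ≤ U ≤ V`,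
`Σ_{U<γ≤V, β≥σ} m(ρ)/γ ≤ B₀(σ,U,V)` (eq. (2.10)).
[cite: FioriKadiriSwidinsky2023, Lemma 2.5] -/
theorem sum_inv_le_B₀_of_countRe {σ T₀ c₁ c₂ p q U V : ℝ} (hT₀ : 2 ≤ T₀) (hp : 0 < p)
    (hp1 : p < 1) (hq : 0 < q)
    (hN : ∀ T : ℝ, T₀ ≤ T → (zetaZeroCountRe σ T : ℝ) ≤ FKS2023.zdbMajorant c₁ c₂ p q T)
    (hU : T₀ ≤ U) (hUV : U ≤ V) :
    ∑ ρ ∈ zerosBetweenRe σ U V, (riemannZetaZeroOrder ρ : ℝ) * (1 / ρ.im) ≤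
      FKS2023.B₀ c₁ c₂ p q U V := by
  have hU1 : 1 < U := by linarith
  have hU0 : 0 < U := by linarith
  have hV0 : 0 < V := by linarith
  have hIcc : uIcc U V = Icc U V := uIcc_of_le hUV
  -- φ = 1/s
  have hφ : ∀ t ∈ Icc U V, HasDerivAt (fun s : ℝ ↦ 1 / s) (-1 / t ^ 2) t := by
    intro t ht
    have ht0 : 0 < t := hU0.trans_le ht.1
    have h := hasDerivAt_inv ht0.ne'
    have h' := h.congr_of_eventuallyEq (f₁ := fun s : ℝ ↦ 1 / s)
      (Filter.Eventually.of_forall fun s ↦ by simp only [one_div])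
    refine h'.congr_deriv ?_
    field_simp
  have hφ' : ContinuousOn (fun t : ℝ ↦ -1 / t ^ 2) (Icc U V) := fun t ht ↦ by
    have ht0 : 0 < t := hU0.trans_le ht.1
    have hne : (fun x : ℝ ↦ x ^ 2) t ≠ 0 := by simp only [ne_eq]; positivity
    exact (continuousAt_const.div (continuousAt_id.pow 2) hne).continuousWithinAt
  have hφ'0 : ∀ t ∈ Icc U V, -1 / t ^ 2 ≤ (0 : ℝ) := fun t ht ↦ by
    have := hU0.trans_le ht.1
    exact div_nonpos_of_nonpos_of_nonneg (by norm_num) (by positivity)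
  -- Ñ is continuous on [U, V]
  have hNcAt : ∀ t, 1 < t → ContinuousAt (fun s ↦ FKS2023.zdbMajorant c₁ c₂ p q s) t := by
    intro t ht1
    have ht0 : 0 < t := by linarith
    have hlt : 0 < Real.log t := Real.log_pos ht1
    have hlog : ContinuousAt (fun s : ℝ ↦ Real.log s) t := Real.continuousAt_log ht0.ne'
    have h1 : ContinuousAt (fun s : ℝ ↦ s ^ p) t := Real.continuousAt_rpow_const _ _ (Or.inl ht0.ne')
    have h2 : ContinuousAt (fun s : ℝ ↦ Real.log s ^ q) t := hlog.rpow_const (Or.inl hlt.ne')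
    unfold FKS2023.zdbMajorant
    exact ((continuousAt_const.mul h1).mul h2).add (continuousAt_const.mul (hlog.pow 2))
  have hNc : ContinuousOn (fun s ↦ FKS2023.zdbMajorant c₁ c₂ p q s) (Icc U V) :=
    fun t ht ↦ (hNcAt t (hU1.trans_le ht.1)).continuousWithinAt
  have hmain := sum_zerosBetweenRe_le_of_countRe_le (σ := σ) hU0.le hUV hφ hφ' hφ'0
    (by positivity : (0 : ℝ) ≤ 1 / V) (fun t ht ↦ hN t (hU.trans ht.1)) hNc
  -- evaluate the integral: ∫ Ñ(t)/t² = c₁ ∫ (log t)^q / t^(2-p) + c₂ ∫ (log t)^2 / t^2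
  have hsplit : ∀ t ∈ uIcc U V, FKS2023.zdbMajorant c₁ c₂ p q t * (-(-1 / t ^ 2)) =
      c₁ * (Real.log t ^ q / t ^ (2 - p)) + c₂ * (Real.log t ^ (2 : ℝ) / t ^ (2 : ℝ)) := by
    intro t ht
    rw [hIcc] at ht
    have ht0 : 0 < t := hU0.trans_le ht.1
    unfold FKS2023.zdbMajorant
    have e1 : t ^ (2 - p) = t ^ 2 / t ^ p := by
      rw [Real.rpow_sub ht0, Real.rpow_two]
    have e2 : (t : ℝ) ^ (2 : ℝ) = t ^ 2 := Real.rpow_two t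
    have e3 : Real.log t ^ (2 : ℝ) = Real.log t ^ 2 := Real.rpow_two _
    rw [e1, e2, e3]
    have htp : 0 < t ^ p := Real.rpow_pos_of_pos ht0 p
    field_simp
  have hI1 := integral_log_rpow_div_rpow hq.le (by linarith : (1 : ℝ) < 2 - p) hU1 hUV
  have hI2 := integral_log_rpow_div_rpow (by norm_num : (0 : ℝ) ≤ 2) (by norm_num : (1 : ℝ) < 2) hU1 hUV
  have hi1 : IntervalIntegrable (fun t ↦ Real.log t ^ q / t ^ (2 - p)) volume U V := by
    refine ContinuousOn.intervalIntegrable_of_Icc hUV fun t ht ↦ ?_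
    have ht0 : 0 < t := hU0.trans_le ht.1
    have hlt : 0 < Real.log t := Real.log_pos (hU1.trans_le ht.1)
    have hlog : ContinuousAt (fun s : ℝ ↦ Real.log s) t := Real.continuousAt_log ht0.ne'
    exact ((hlog.rpow_const (Or.inl hlt.ne')).div (Real.continuousAt_rpow_const _ _ (Or.inl ht0.ne'))
      (Real.rpow_pos_of_pos ht0 _).ne').continuousWithinAt
  have hi2 : IntervalIntegrable (fun t ↦ Real.log t ^ (2 : ℝ) / t ^ (2 : ℝ)) volume U V := by
    refine ContinuousOn.intervalIntegrable_of_Icc hUV fun t ht ↦ ?_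
    have ht0 : 0 < t := hU0.trans_le ht.1
    have hlt : 0 < Real.log t := Real.log_pos (hU1.trans_le ht.1)
    have hlog : ContinuousAt (fun s : ℝ ↦ Real.log s) t := Real.continuousAt_log ht0.ne'
    exact ((hlog.rpow_const (Or.inl hlt.ne')).div (Real.continuousAt_rpow_const _ _ (Or.inl ht0.ne'))
      (Real.rpow_pos_of_pos ht0 _).ne').continuousWithinAt
  have hint : ∫ t in U..V, FKS2023.zdbMajorant c₁ c₂ p q t * (-(-1 / t ^ 2)) =
      (c₁ * ∫ t in U..V, Real.log t ^ q / t ^ (2 - p))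
        + c₂ * ∫ t in U..V, Real.log t ^ (2 : ℝ) / t ^ (2 : ℝ) := by
    rw [intervalIntegral.integral_congr hsplit, intervalIntegral.integral_add (hi1.const_mul c₁)
      (hi2.const_mul c₂), intervalIntegral.integral_const_mul, intervalIntegral.integral_const_mul]
  rw [hint, hI1, hI2] at hmain
  -- compare with B₀
  unfold FKS2023.B₀
  have eV : FKS2023.zdbMajorant c₁ c₂ p q V * (1 / V) =
      c₁ * Real.log V ^ q / V ^ (1 - p) + c₂ * Real.log V ^ 2 / V := by
    unfold FKS2023.zdbMajorant
    have e1 : V ^ (1 - p) = V / V ^ p := by rw [Real.rpow_sub hV0, Real.rpow_one]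
    rw [e1]
    have hVp : 0 < V ^ p := Real.rpow_pos_of_pos hV0 p
    field_simp
  have e2 : (2 : ℝ) - 1 = 1 := by norm_num
  have e3 : (2 : ℝ) + 1 = 3 := by norm_num
  have e4 : (2 : ℝ) - p - 1 = 1 - p := by ring
  rw [e2, e3, one_mul, one_mul, Real.one_rpow, div_one, e4] at hmain
  rw [eV] at hmain
  have e5 : c₁ * ((upperIncGamma (q + 1) ((1 - p) * Real.log U) -
      upperIncGamma (q + 1) ((1 - p) * Real.log V)) / (1 - p) ^ (q + 1)) =
      c₁ / (1 - p) ^ (q + 1) * (upperIncGamma (q + 1) ((1 - p) * Real.log U) -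
        upperIncGamma (q + 1) ((1 - p) * Real.log V)) := by ring
  linarith [hmain, e5]

/-- **`B₀(·, V)` is continuous at every `U > 1`** (`0 < p < 1`, `q > 0`).
[cite: FioriKadiriSwidinsky2023, Lemma 2.5 eq. (2.10)] -/
theorem FKS2023.continuousAt_B₀ {c₁ c₂ p q U V : ℝ} (hp1 : p < 1) (hq : 0 < q) (hU : 1 < U) :
    ContinuousAt (fun u ↦ FKS2023.B₀ c₁ c₂ p q u V) U := by
  have hU0 : 0 < U := by linarith
  have hlogU : 0 < Real.log U := Real.log_pos hU
  have hlog : ContinuousAt (fun u : ℝ ↦ Real.log u) U := Real.continuousAt_log hU0.ne'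
  have h1 : ContinuousAt (fun u : ℝ ↦ upperIncGamma (q + 1) ((1 - p) * Real.log u)) U :=
    (continuousAt_upperIncGamma (by linarith) (by nlinarith)).comp (continuousAt_const.mul hlog)
  have h2 : ContinuousAt (fun u : ℝ ↦ upperIncGamma 3 (Real.log u)) U :=
    (continuousAt_upperIncGamma (by norm_num) hlogU).comp hlog
  unfold FKS2023.B₀
  exact ((continuousAt_const.add (continuousAt_const.mul (h1.sub continuousAt_const))).add
    (continuousAt_const.mul (h2.sub continuousAt_const)))

/-- Sums of `m(ρ)/γ` over sub-windows with `β ≥ σ` are monotone: for `S ⊆ zerosBetweenRe σ U' V`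
(`U' ≥ 0`), `Σ_S m(ρ)/γ ≤ Σ_{U'<γ≤V, β≥σ} m(ρ)/γ`. [folklore] -/
private theorem sum_inv_le_sum_inv_of_subset_re {σ U' V : ℝ} (hU' : 0 ≤ U') {S : Finset ℂ}
    (hS : S ⊆ zerosBetweenRe σ U' V) :
    ∑ ρ ∈ S, (riemannZetaZeroOrder ρ : ℝ) * (1 / ρ.im) ≤
      ∑ ρ ∈ zerosBetweenRe σ U' V, (riemannZetaZeroOrder ρ : ℝ) * (1 / ρ.im) := by
  refine Finset.sum_le_sum_of_subset_of_nonneg hS fun ρ hρ _ ↦ ?_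
  obtain ⟨hz, -, -, h3, -⟩ := (mem_zerosBetweenRe hU').1 hρ
  have hm : (0 : ℝ) ≤ riemannZetaZeroOrder ρ :=
    Int.cast_nonneg (riemannZetaZeroOrder_nonneg (ne_one_of_riemannZeta_eq_zero hz))
  have : 0 < ρ.im := hU'.trans_lt h3
  positivity

/-- **FKS Lemma 2.5** for the CLOSED window `U ≤ γ ≤ V` (containing the printed `U ≤ γ < V`),
`T₀ < U`: under the (ZDB) majorant hypothesis for `T ≥ T₀`, for every tree window `(U₀, V]`
(`U₀ ≥ 0`) the zeros in it with `β ≥ σ`, `Im ρ ≥ U` satisfy `Σ m(ρ)/γ ≤ B₀(σ,U,V)`. (At `U = T₀`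
itself use `sum_inv_le_B₀_of_countRe`.) Proof: window `(U',V]`, `U' ↑ U`, and continuity of
`B₀(·,V)`. [cite: FioriKadiriSwidinsky2023, Lemma 2.5] -/
theorem FioriKadiriSwidinsky2023_lemma24 {σ T₀ c₁ c₂ p q U₀ U V : ℝ} (hT₀ : 2 ≤ T₀) (hp : 0 < p)
    (hp1 : p < 1) (hq : 0 < q)
    (hN : ∀ T : ℝ, T₀ ≤ T → (zetaZeroCountRe σ T : ℝ) ≤ FKS2023.zdbMajorant c₁ c₂ p q T)
    (hU₀ : 0 ≤ U₀) (hU : T₀ < U) (hUV : U ≤ V) :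
    ∑ ρ ∈ (zerosBetweenRe σ U₀ V).filter (fun ρ ↦ U ≤ ρ.im),
        (riemannZetaZeroOrder ρ : ℝ) * (1 / ρ.im) ≤ FKS2023.B₀ c₁ c₂ p q U V := by
  set S := (zerosBetweenRe σ U₀ V).filter (fun ρ ↦ U ≤ ρ.im) with hSdef
  have hbound : ∀ U' ∈ Ioo T₀ U,
      ∑ ρ ∈ S, (riemannZetaZeroOrder ρ : ℝ) * (1 / ρ.im) ≤ FKS2023.B₀ c₁ c₂ p q U' V := by
    intro U' hU'
    obtain ⟨h1, h2⟩ := hU'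
    have hU'0 : 0 ≤ U' := by linarith
    have hsub : S ⊆ zerosBetweenRe σ U' V := by
      intro ρ hρ
      rw [hSdef, Finset.mem_filter, mem_zerosBetweenRe hU₀] at hρ
      obtain ⟨⟨hz, ha, hb, -, hd⟩, hU'⟩ := hρ
      exact (mem_zerosBetweenRe hU'0).2 ⟨hz, ha, hb, by linarith, hd⟩
    refine (sum_inv_le_sum_inv_of_subset_re hU'0 hsub).trans ?_
    exact sum_inv_le_B₀_of_countRe hT₀ hp hp1 hq hN h1.le (h2.le.trans hUV)
  have hcont := (FKS2023.continuousAt_B₀ (c₁ := c₁) (c₂ := c₂) (V := V) hp1 hq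
    (by linarith : (1 : ℝ) < U)).tendsto
  have hev : ∀ᶠ U' in 𝓝[<] U,
      ∑ ρ ∈ S, (riemannZetaZeroOrder ρ : ℝ) * (1 / ρ.im) ≤ FKS2023.B₀ c₁ c₂ p q U' V :=
    mem_of_superset (Ioo_mem_nhdsLT hU) hbound
  exact ge_of_tendsto (hcont.mono_left nhdsWithin_le_nhds) hev

end Literature.NumberTheory.LFunctions

end
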